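import Summits.ResolutionOfSingularities.ResolutionOfSingularities.Theorems.HomologicalConductorNoZenoRRelativelyMinimal
import Summits.ResolutionOfSingularities.ResolutionOfSingularities.Theorems.HomologicalConductorNoZenoRCriterionM
import HarnessLib

/-!
# Crux `NoZenoR` (stmt-ResolutionOfSingularities-19943) — relatively minimal ⟺ criterion (M), from Lipman (27.1)
# alone; (27.3) from (27.1) and the LOCAL existence of a minimal desingularization

Route `ResolutionOfSingularities/HomologicalConductor` (cell decomp-res, hand leafhand-res-homologicalconduct-18 g1).
OURS: AI-written bookkeeping over tree theorems, weaker than expert review; nothing here is a statement of the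
manuscript under review (Hironaka 2017).  SUPPORT level, counted 0.  Def-free, no new named facts;
FACT-PARAMETRIC in `Lipman1969_27_1_reg_rat` where stated.

`S` a two-dimensional Noetherian local normal domain with a rational singularity, `π : X → Spec S` a desingularization;
"relatively minimal" = every `S`-morphism from `X` to a desingularization is an isomorphism (spelled out inline).

* `h0_sq_ne_three_mul_of_forall_isIso` — (27.1) ⇒ a RELATIVELY minimal desingularization has no first-kind curve
  (hand 7's `…MinimalNoFirstKind.h0_sq_ne_three_mul_of_isMinimalResolution` with minimality weakened to relative
  minimality: the contraction of (27.1) would be an isomorphism);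
* `criterionM_of_forall_isIso` — hence satisfies (M) `3·h⁰(𝓘_η) < h⁰(𝓘_η²)` (`≤` is the tree theorem
  `three_mul_h0_le_h0_sq_holds`);
* `forall_isIso_iff_criterionM_of_27_1` — with the unconditional converse `FirstKind.forall_isIso_of_criterionM`
  ((F), hands 16 g3 + 18 g1): under (27.1), relatively minimal ⟺ (M);
* `exists_criterionM_of_27_1` — under (27.1), `Spec S` HAS a desingularization satisfying (M) (the relatively minimal
  model below any desingularization, `FirstKind.exists_fac_forall_isIso`);
* `isMinimalResolution_iff_criterionM_of_27_1_of_exists` / `Lipman1969_27_3_rat_of_27_1_of_exists_minimal` —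
  Lipman (27.3) from (27.1) and the mere EXISTENCE of a minimal desingularization of each such `Spec S` (the LOCAL
  form in which Theorem (4.1) is consumed by `stub_minResolutionExists`), instead of the global `Lipman1969_4_1`.

No crux or summit statement is proved here.
-/

noncomputable section

-- single-problem summit: the doubled namespace component `ResolutionOfSingularities` is forced
set_option linter.dupNamespace false

open CategoryTheory AlgebraicGeometry TopologicalSpace Topology IsLocalRing
open Literature.AlgebraicGeometry.Resolution
open Scheme.IdealSheafData
open Summit.ResolutionOfSingularities.ResolutionOfSingularities.Theorems.NoZeno.ExcCount

namespace Summit.ResolutionOfSingularities.ResolutionOfSingularities.Theorems.NoZeno.FirstKind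

universe u

section AnyUniverse

variable {S : Type u} [CommRing S] [IsNoetherianRing S] [IsLocalRing S] [IsDomain S] [IsIntegrallyClosed S]
  {X : Scheme.{u}} {π : X ⟶ Spec (.of S)}

/-- **(27.1) ⇒ a relatively minimal desingularization carries no first-kind curve.**  If every `S`-morphism from the
desingularization `π : X → Spec S` (of a rational surface singularity) to a desingularization is an isomorphism, then
`h⁰(𝓘_η²) ≠ 3·h⁰(𝓘_η)` for every integral exceptional curve: (27.1) at `F = {η}` would contract `cl{η}` by an
`S`-morphism `h` with `h⁻¹(h η) = cl{η}`; `h` is an isomorphism, so `cl{η} = {η}` is closed, against `height η = 1`.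
[cite: Lipman1969, Theorem (27.1) (p. 275) and Corollary (27.3) (p. 277)] -/
theorem h0_sq_ne_three_mul_of_forall_isIso (h271 : Lipman1969_27_1_reg_rat.{u}) (h2 : ringKrullDim S = 2)
    (hS : HasRationalSingularity S) (hπ : IsResolution π)
    (hrel : ∀ (Y : Scheme.{u}) (g : Y ⟶ Spec (.of S)) (k : X ⟶ Y), IsResolution g → k ≫ g = π → IsIso k)
    {η : X} (hη : η ∈ excCurvePoints π) :
    h0 π (primeDivisorIdeal η ^ 2) ≠ 3 * h0 π (primeDivisorIdeal η) := by
  intro heq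
  obtain ⟨Y, g, h, hc, hC, hfac, hg, hfib, -⟩ :=
    h271 S h2 hS X π hπ {η} (Set.finite_singleton η) (Set.singleton_subset_iff.2 hη)
      (fun a ha b hb hab => (hab ((Set.mem_singleton_iff.1 ha).trans (Set.mem_singleton_iff.1 hb).symm)).elim)
      (fun a ha => by rw [Set.mem_singleton_iff.1 ha]; exact heq)
  haveI : IsIso h := hrel Y g h hg hfac
  have hinj : Function.Injective h.base := (Scheme.homeoOfIso (asIso h)).injective
  have hcl : closure ({η} : Set X) = {η} := by
    rw [← hfib η (Set.mem_singleton η), ← Set.image_singleton, hinj.preimage_image]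
  have hclosed : IsClosed ({η} : Set X) := closure_eq_iff_isClosed.1 hcl
  have h0' : Order.height η = 0 := Scheme.height_of_isClosed hclosed
  have h1 : Order.height η = 1 := hη.2
  rw [h0'] at h1
  exact zero_ne_one h1

/-- **(27.1) ⇒ relatively minimal desingularizations satisfy (M)**: `3·h⁰(𝓘_η) < h⁰(𝓘_η²)` for every integral
exceptional curve (`≤` unconditionally, `three_mul_h0_le_h0_sq_holds`; `≠` by `h0_sq_ne_three_mul_of_forall_isIso`).
[cite: Lipman1969, Corollary (27.3) (p. 277)] -/
theorem criterionM_of_forall_isIso (h271 : Lipman1969_27_1_reg_rat.{u}) (h2 : ringKrullDim S = 2)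
    (hS : HasRationalSingularity S) (hπ : IsResolution π)
    (hrel : ∀ (Y : Scheme.{u}) (g : Y ⟶ Spec (.of S)) (k : X ⟶ Y), IsResolution g → k ≫ g = π → IsIso k) :
    ∀ η ∈ excCurvePoints π, 3 * h0 π (primeDivisorIdeal η) < h0 π (primeDivisorIdeal η ^ 2) :=
  fun _η hη => lt_of_le_of_ne (MinimalNoFirstKind.three_mul_h0_le_h0_sq_holds h2 hS hπ hη)
    (h0_sq_ne_three_mul_of_forall_isIso h271 h2 hS hπ hrel hη).symm

end AnyUniverse

section UniverseZero

variable {S : Type} [CommRing S] [IsNoetherianRing S] [IsLocalRing S] [IsDomain S] [IsIntegrallyClosed S]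

/-- **Under (27.1): relatively minimal ⟺ criterion (M)** for desingularizations of a rational surface singularity
(«⇒» `criterionM_of_forall_isIso`; «⇐» the first-kind clause (F), `forall_isIso_of_criterionM`, unconditional).
[cite: Lipman1969, Corollary (27.3) (p. 277)] -/
theorem forall_isIso_iff_criterionM_of_27_1 (h271 : Lipman1969_27_1_reg_rat.{0}) (h2 : ringKrullDim S = 2)
    (hS : HasRationalSingularity S) {X : Scheme.{0}} {π : X ⟶ Spec (.of S)} (hπ : IsResolution π) :
    (∀ (Y : Scheme.{0}) (g : Y ⟶ Spec (.of S)) (k : X ⟶ Y), IsResolution g → k ≫ g = π → IsIso k) ↔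
      ∀ η ∈ excCurvePoints π, 3 * h0 π (primeDivisorIdeal η) < h0 π (primeDivisorIdeal η ^ 2) :=
  ⟨criterionM_of_forall_isIso h271 h2 hS hπ, forall_isIso_of_criterionM h2 hπ⟩

/-- **Under (27.1), `Spec S` has a desingularization satisfying (M)** (no integral exceptional curve of the first
kind): the relatively minimal model below any desingularization (`exists_fac_forall_isIso`; a desingularization exists
because the singularity is rational). [cite: Lipman1969, Corollary (27.3), proof (p. 277)] -/
theorem exists_criterionM_of_27_1 (h271 : Lipman1969_27_1_reg_rat.{0}) (h2 : ringKrullDim S = 2)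
    (hS : HasRationalSingularity S) :
    ∃ (X : Scheme.{0}) (π : X ⟶ Spec (.of S)), IsResolution π ∧
      ∀ η ∈ excCurvePoints π, 3 * h0 π (primeDivisorIdeal η) < h0 π (primeDivisorIdeal η ^ 2) := by
  have hS' := hS
  obtain ⟨Z, g, hg, -⟩ := hS'
  obtain ⟨X, π, -, hπ, -, hrel⟩ := exists_fac_forall_isIso h2 hg
  exact ⟨X, π, hπ, criterionM_of_forall_isIso h271 h2 hS hπ hrel⟩

/-- **Lipman (27.3) from (27.1) and the EXISTENCE of a minimal desingularization of `Spec S`** (instead of the global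
Theorem (4.1)): `IsMinimalResolution π ↔ (M)`. [cite: Lipman1969, Corollary (27.3) (p. 277; proof pp. 277–278)] -/
theorem isMinimalResolution_iff_criterionM_of_27_1_of_exists (h271 : Lipman1969_27_1_reg_rat.{0})
    (h2 : ringKrullDim S = 2) (hS : HasRationalSingularity S)
    (hmin : ∃ (X₀ : Scheme.{0}) (f₀ : X₀ ⟶ Spec (.of S)), IsMinimalResolution f₀)
    {X : Scheme.{0}} {π : X ⟶ Spec (.of S)} (hπ : IsResolution π) :
    IsMinimalResolution π ↔
      ∀ η ∈ excCurvePoints π, 3 * h0 π (primeDivisorIdeal η) < h0 π (primeDivisorIdeal η ^ 2) := by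
  rw [isMinimalResolution_iff_forall_isIso hmin hπ]
  exact forall_isIso_iff_criterionM_of_27_1 h271 h2 hS hπ

omit [CommRing S] [IsNoetherianRing S] [IsLocalRing S] [IsDomain S] [IsIntegrallyClosed S] in
/-- **The named fact `Lipman1969_27_3_rat` (universe `0`) follows from `Lipman1969_27_1_reg_rat` and the LOCAL existence
of minimal desingularizations** — «every two-dimensional Noetherian local normal domain with a rational singularity
has a minimal desingularization of its spectrum», the form in which Theorem (4.1) is actually consumed by the crux's
`stub_minResolutionExists`. [cite: Lipman1969, Corollary (27.3) (p. 277), Theorem (27.1) (p. 275), Theorem (4.1) (p. 204)] -/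
theorem Lipman1969_27_3_rat_of_27_1_of_exists_minimal (h271 : Lipman1969_27_1_reg_rat.{0})
    (hmin : ∀ (S : Type) [CommRing S] [IsNoetherianRing S] [IsLocalRing S] [IsDomain S] [IsIntegrallyClosed S],
      ringKrullDim S = 2 → HasRationalSingularity S →
        ∃ (X₀ : Scheme.{0}) (f₀ : X₀ ⟶ Spec (.of S)), IsMinimalResolution f₀) :
    Lipman1969_27_3_rat.{0} := by
  intro S _ _ _ _ _ h2 hS X π hπ
  exact isMinimalResolution_iff_criterionM_of_27_1_of_exists h271 h2 hS (hmin S h2 hS) hπ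

end UniverseZero

end Summit.ResolutionOfSingularities.ResolutionOfSingularities.Theorems.NoZeno.FirstKind

end
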